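import Summits.QuantumFields.YangMills.Theorems.UnitScaleTiltHalvingSmallMembersCoverLift
import Literature.MathematicalPhysics.QuantumFieldTheory.Balaban1983to89.T3Thm1CarrierNative
import Literature.MathematicalPhysics.QuantumFieldTheory.Balaban1983to89.T3SectALandauChart
import HarnessLib

/-!
# Route `UnitScaleTilt`, crux K1 child «MinimiserStabilityRegPr» (stmt-QuantumFields-19200), stub `stub_halvingStep` (H), residual «H-SMALL», route (b7) «COVER LIFT»
# (★★OWNER RULINGS №28∕№30 (4)) — **LIFT PACKAGE, FILE 2a: THE ASSEMBLY `stub_of_roomHalvingStat`** — the registered stub's text at EVERY member from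
# (i) LEAD-H's first-order with-room door `RoomHalvingTextStat` (RULING L-7 (a), text VERBATIM, inline) and (ii) ONE displayed analytic input `hlift`
# («R2-criticality at a member ⇒ stationarity of the Wilson action along every bondwise-differentiable exact-fibre curve through the lift at the cover member»,
# = FILE 2b `…CoverLiftStat`'s conclusion)

Cell `ym3-torus` (HUMAN RULING D-0037: YM₃ on T³ is ladder rung R3, not the Clay problem), width seat `ym-ust-20520-w3` gen 5.  `--supports stmt-QuantumFields-19200 --as helper`;
def-free, 0 sorry, standard axioms.  CONDITIONAL: nothing here closes the stub — `RoomHalvingTextStat` (door v3, ★w3-19200 g5) and `hlift` (FILE 2b) are hypotheses.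

WHY.  At a member without room the datum is lifted to the cover member `F.cover jc` (✓`SmallMembersCoverLift`: `Reg7`∕`InU`∕`InB` lift, `InU` descends); the carrier's
`IsCritical` (minimality, reading R2) does NOT lift, but the FIRST-ORDER clause of `RoomHalvingTextStat` is fed by `hlift`; the room premise `N ≤ L^{m + jc + n}` holds for
`jc := N` (`N < 2^N ≤ L^N`); the conclusion `InU (max (B₃ε₁) (ε₀∕2))` descends.  Every member (with or without room) goes through its cover — no case split.

WHAT IS PROVED: `le_pow_cover` (the room arithmetic), ★★★`stub_of_roomHalvingStat`.

References: T. Bałaban, CMP **102** (1985) 277–309 [Balaban1985Variational] (Thm 1 p.279, (2)–(8) p.278–279, Prop. 8 p.304, (144) p.300).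
-/

set_option autoImplicit false

noncomputable section

open scoped Matrix.Norms.L2Operator

namespace Summit.QuantumFields.YangMills.Theorems.SmallMembersCoverLiftStub

open Literature.MathematicalPhysics.QuantumFieldTheory.Balaban1983to89
open T3ContinuumYM3Torus (T3Family)
open T3Thm1Carrier (famX Idx)
open T3Thm1CarrierNative (IsCritR2)
open T3PrintedRegularMinimiser (RegPr)
open T3ConstrainedMinimiser (fibre)
open T3UnitLawDensityEML (ℰp)
open T3SectALandauChart (pos_of_regPr)
open CoverSites (cover proj projBond)
open SmallMembersCoverLift (famX_inU_cover_iff famX_reg7_cover_iff famX_inB_cover_iff)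

/-- **THE ROOM ARITHMETIC**: `N ≤ L^{a + N}` for `2 ≤ L` (the cover `F.cover N` of any member has room `N`). [folklore] -/
theorem le_pow_cover {L : ℕ} (hL : 2 ≤ L) (N a : ℕ) : N ≤ L ^ (a + N) :=
  calc N ≤ 2 ^ N := (Nat.lt_two_pow_self).le
    _ ≤ L ^ N := Nat.pow_le_pow_left hL N
    _ ≤ L ^ (a + N) := Nat.pow_le_pow_right (by omega) (Nat.le_add_left N a)

/-- ★★★ **THE REGISTERED STUB `stub_halvingStep` FROM THE FIRST-ORDER WITH-ROOM DOOR AND THE COVER LIFT OF STATIONARITY.**  Hypotheses: `hlift` = FILE 2b's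
conclusion (R2-critical at the member ⇒ the Wilson action is stationary along every bondwise-differentiable curve through the lifted field inside the cover member's
exact fibre of the lifted datum), displayed with its own smallness `aS(L)`; `H : ∀ L, RoomHalvingTextStat L` = LEAD-H RULING L-7 (a) VERBATIM (door v3).  Conclusion: the text of
`Cruxes/MinimiserStabilityRegPr/Lines/birth_v10.lean`'s `stub_halvingStep`, verbatim.  Proof: per member `⟨F, n, K⟩` take `jc := N`; lift `Reg7`∕`InU`∕`InB`
(✓`famX_reg7∕inU∕inB_cover_iff`), feed the first-order clause by `hlift` (`IsCritical` = `IsCritR2`, ✓`isCritical_famX_iff`), apply `H` at the cover index, descend `InU`.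
[cite: Balaban1985Variational, Thm 1 p.279, Prop. 8 p.304, (144) p.300] -/
theorem stub_of_roomHalvingStat
    (hlift : ∀ L : ℕ, 1 < L → ∃ aS : ℝ, 0 < aS ∧ ∀ (F : T3Family), F.L = L → ∀ (jc n K : ℕ) (hnK : n < K) (ε₀ : ℝ)
      (V : GaugeField (F.P n) 0 (Matrix.specialUnitaryGroup (Fin 2) ℂ)) (U : GaugeField (F.P K) 0 (Matrix.specialUnitaryGroup (Fin 2) ℂ)),
      0 < ε₀ → ε₀ ≤ aS → RegPr F n K ε₀ U → IsCritR2 F n K hnK.le V U →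
      ∀ γ : ℝ → GaugeField ((F.cover jc).P K) 0 (Matrix.specialUnitaryGroup (Fin 2) ℂ), γ 0 = U ∘ projBond (F.P K) jc 0 →
        (∀ t, γ t ∈ fibre (F.cover jc) ℰp n K hnK.le (V ∘ projBond (F.P n) jc 0)) →
        (∀ b, DifferentiableAt ℝ (fun t => ((γ t b : Matrix.specialUnitaryGroup (Fin 2) ℂ) : Matrix (Fin 2) (Fin 2) ℂ)) 0) →
        deriv (fun t => wilsonAction4 (γ t)) 0 = 0)
    (H : ∀ L : ℕ, 1 < L → ∃ B₃ : ℝ, 4 < B₃ ∧ ∃ a₅ : ℝ, 0 < a₅ ∧ ∃ N : ℕ, ∀ (i : Idx L), N ≤ (i.1.1).L ^ ((i.1.1).m + i.1.2.1) →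
      ∀ (ε₀ ε₁ : ℝ), 0 < ε₁ → ∀ (V : (famX L i).Bdry) (U : (famX L i).Cfg), (famX L i).Reg7 ε₁ V → (famX L i).InU ε₀ U → (famX L i).InB V U →
      (∀ γ : ℝ → GaugeField ((i.1.1).P i.1.2.2) 0 (Matrix.specialUnitaryGroup (Fin 2) ℂ), γ 0 = U →
        (∀ t, γ t ∈ fibre i.1.1 ℰp i.1.2.1 i.1.2.2 i.2.2.le V) →
        (∀ b, DifferentiableAt ℝ (fun t => ((γ t b : Matrix.specialUnitaryGroup (Fin 2) ℂ) : Matrix (Fin 2) (Fin 2) ℂ)) 0) →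
        deriv (fun t => wilsonAction4 (γ t)) 0 = 0) →
      ε₀ ≤ a₅ → (famX L i).InU (max (B₃ * ε₁) (ε₀ / 2)) U) :
    ∀ (L : ℕ), 1 < L → ∃ B₃ : ℝ, 4 < B₃ ∧ ∃ a₅ : ℝ, 0 < a₅ ∧
      ∀ (i : Idx L) (ε₀ ε₁ : ℝ), 0 < ε₁ → ∀ (V : (famX L i).Bdry) (U : (famX L i).Cfg), (famX L i).Reg7 ε₁ V → (famX L i).InU ε₀ U →
        (famX L i).InB V U → (famX L i).IsCritical V U → ε₀ ≤ a₅ → (famX L i).InU (max (B₃ * ε₁) (ε₀ / 2)) U := by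
  intro L hL
  obtain ⟨B₃, hB₃, a₅, ha₅, N, hH⟩ := H L hL
  obtain ⟨aS, haS, hS⟩ := hlift L hL
  refine ⟨B₃, hB₃, min a₅ aS, lt_min ha₅ haS, ?_⟩
  rintro ⟨⟨F, n, K⟩, hF, hnK⟩ ε₀ ε₁ hε₁ V U hV hU hB hcrit hε₀a
  -- the cover index with room `N`
  let ic : Idx L := ⟨(F.cover N, n, K), ⟨hF, hnK⟩⟩
  have hroom : N ≤ (ic.1.1).L ^ ((ic.1.1).m + ic.1.2.1) := by
    show N ≤ F.L ^ (F.m + N + n)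
    have hL2 : 2 ≤ F.L := by rw [hF]; exact hL
    calc N ≤ F.L ^ (F.m + n + N) := le_pow_cover hL2 N (F.m + n)
      _ = F.L ^ (F.m + N + n) := by rw [Nat.add_right_comm]
  -- the member's data: `0 < ε₀` from `InU`, R2-criticality from `IsCritical`
  have hreg : RegPr F n K ε₀ U := hU
  have hε₀ : 0 < ε₀ := pos_of_regPr F hreg
  have hcritR2 : IsCritR2 F n K hnK.le V U := hcrit
  -- lift the three letters to the cover member
  have hV' : (famX L ic).Reg7 ε₁ (V ∘ projBond (F.P n) N 0) := (famX_reg7_cover_iff N ⟨(F, n, K), hF, hnK⟩ ε₁ V).2 hV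
  have hU' : (famX L ic).InU ε₀ (U ∘ projBond (F.P K) N 0) := (famX_inU_cover_iff N ⟨(F, n, K), hF, hnK⟩ ε₀ U).2 hU
  have hB' : (famX L ic).InB (V ∘ projBond (F.P n) N 0) (U ∘ projBond (F.P K) N 0) := (famX_inB_cover_iff N ⟨(F, n, K), hF, hnK⟩ V U).2 hB
  -- stationarity at the cover member (FILE 2b)
  have hstat := hS F hF N n K hnK ε₀ V U hε₀ (hε₀a.trans (min_le_right _ _)) hreg hcritR2
  -- the first-order door at the cover index, then descend the conclusion
  have hconc := hH ic hroom ε₀ ε₁ hε₁ (V ∘ projBond (F.P n) N 0) (U ∘ projBond (F.P K) N 0) hV' hU' hB' hstat (hε₀a.trans (min_le_left _ _))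
  exact (famX_inU_cover_iff N ⟨(F, n, K), hF, hnK⟩ (max (B₃ * ε₁) (ε₀ / 2)) U).1 hconc

end Summit.QuantumFields.YangMills.Theorems.SmallMembersCoverLiftStub

end
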